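import Summits.FinalStateConjecture.FinalStateConjecture.Theorems.CaptureSuffices.Negative.KerrMassPinning
import Mathlib.MeasureTheory.Measure.Lebesgue.EqHaar

/-!
# `CaptureSuffices` (crux `stmt-FinalStateConjecture-9953`, route `PhaseMixingCapture`):
# naked and exposed-edge members of the capture basins — tightness of the ceiling `γ ≥ 1`

Negative-side support file of the crux disprover (cdisprove seat, cycle 2), companion of
`NakedMemberThresholds.lean` / `NakedMembers.lean` (the `γ < 1` falsity, modulo print-true
hypotheses). This file is UNCONDITIONAL: no hypotheses beyond the Kerr chart-fact instances, no
definitions, no named facts, `sorry`-free.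

* `setLIntegral_ge_shell`: a function `≥ κ` on the dyadic shell `{R < ‖y‖ ≤ 2R} ⊆ U` has
  `∫_U f ≥ 7R³κ·|B₁|`.
* `dataWeightedSobolevEDist_kerr_ge`: for EVERY `(s, δ)` and `R ≥ Kerr.afRadius a r₀ + 2|a|`, two
  members `Kerr.data M a r₀`, `Kerr.data M' a r₀` of the mass family at fixed spin are at
  `H^s_δ × H^{s-1}_{δ+1}` distance at least `(7R³ · min(1, (1 + 2R)^{2δ}) · (M − M')²/(2R)² · |B₁|)^{1/2}`
  — the `m = 0` term of the `h`-part over the shell, where the pointwise bound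
  `‖h_M − h_{M'}‖ ≥ |M − M'|/‖y‖` of `KerrMassPinning.lean` holds. (For `δ ≥ -1/2` the distance is
  in fact `⊤`, `KerrMassPinningCritical.lean`; the point here is the linear-in-`|ΔM|` bound with a
  constant uniform in the spin.)
* `exists_const_basin_clears_visibleEdge`: for every `M > 0` there is `K'(M, δ) > 0` such that for
  every sub-extremal spin `a`, every `γ ≥ 1`, every `0 ≤ c ≤ K'M/2` and every member of mass
  defect `M − M' ≥ Mχ/2` (`χ = 1 − (a/M)²`; this covers every exposed-edge and every overspinning
  member, `NakedMemberThresholds.lean`), the member is NOT in the near-extremal basin `c·χ^γ` of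
  item 10606 around `Kerr.data M a M`. Together with `near_inner_false_of_gamma_lt_one`
  (`NakedMembers.lean`: for `γ < 1` the naked members ARE in the basin and the item's clause fails)
  this pins the kinematic ceiling of the near-extremal hypothesis of the crux at exactly `γ = 1`
  with `c(M) = O(M)`, uniformly in the spin.
-/

-- the problem namespace `FinalStateConjecture.FinalStateConjecture` (single-conjunct summit) trips dupNamespace
set_option linter.dupNamespace false

noncomputable section

open scoped Manifold ContDiff Topology ENNReal
open Set Filter MeasureTheory

namespace Summit.FinalStateConjecture.FinalStateConjecture.Theorems.CaptureSuffices.Negative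

open Literature.Geometry.Lorentzian

/-- Shell lower bound: a function `≥ κ` on the dyadic shell `{R < ‖y‖ ≤ 2R} ⊆ U` has
`∫_U f ≥ 7R³κ·|B₁|`. -/
theorem setLIntegral_ge_shell {κ R : ℝ} (hR : 0 < R) {U : Set E3}
    (hU : {y : E3 | R < ‖y‖} ⊆ U) {f : E3 → ℝ≥0∞}
    (hf : ∀ y : E3, R < ‖y‖ → ‖y‖ ≤ 2 * R → ENNReal.ofReal κ ≤ f y) :
    ENNReal.ofReal (7 * R ^ 3 * κ) * volume (Metric.ball (0 : E3) 1) ≤ ∫⁻ y in U, f y := by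
  set b : ℝ≥0∞ := volume (Metric.ball (0 : E3) 1) with hb
  have hbtop : b ≠ ⊤ := measure_ball_lt_top.ne
  set A : Set E3 := Metric.closedBall 0 (2 * R) \ Metric.closedBall 0 R with hA
  have hAU : A ⊆ U := fun y hy ↦ hU (lt_of_not_ge fun h ↦ hy.2 (mem_closedBall_zero_iff.2 h))
  have hAm : MeasurableSet A := measurableSet_closedBall.diff measurableSet_closedBall
  have hfA : ∀ y ∈ A, ENNReal.ofReal κ ≤ f y := fun y hy ↦
    hf y (lt_of_not_ge fun h ↦ hy.2 (mem_closedBall_zero_iff.2 h)) (mem_closedBall_zero_iff.1 hy.1)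
  have hvol : ENNReal.ofReal (7 * R ^ 3) * b ≤ volume A := by
    have h1 : volume (Metric.closedBall (0 : E3) (2 * R)) = ENNReal.ofReal ((2 * R) ^ 3) * b := by
      rw [Measure.addHaar_closedBall volume (0 : E3) (by positivity : (0 : ℝ) ≤ 2 * R),
        finrank_euclideanSpace_fin]
    have h2 : volume (Metric.closedBall (0 : E3) R) = ENNReal.ofReal (R ^ 3) * b := by
      rw [Measure.addHaar_closedBall volume (0 : E3) hR.le, finrank_euclideanSpace_fin]
    calc ENNReal.ofReal (7 * R ^ 3) * b
        = ENNReal.ofReal ((2 * R) ^ 3 - R ^ 3) * b := by congr 1; ring_nf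
      _ = (ENNReal.ofReal ((2 * R) ^ 3) - ENNReal.ofReal (R ^ 3)) * b := by
          rw [ENNReal.ofReal_sub _ (by positivity)]
      _ = ENNReal.ofReal ((2 * R) ^ 3) * b - ENNReal.ofReal (R ^ 3) * b := by
          rw [ENNReal.sub_mul fun _ _ ↦ hbtop]
      _ = volume (Metric.closedBall (0 : E3) (2 * R)) - volume (Metric.closedBall (0 : E3) R) := by
          rw [h1, h2]
      _ ≤ volume A := le_measure_sdiff
  calc ENNReal.ofReal (7 * R ^ 3 * κ) * b
      = ENNReal.ofReal (7 * R ^ 3) * ENNReal.ofReal κ * b := by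
        rw [ENNReal.ofReal_mul (by positivity)]
    _ = ENNReal.ofReal κ * (ENNReal.ofReal (7 * R ^ 3) * b) := by ring
    _ ≤ ENNReal.ofReal κ * volume A := mul_le_mul' le_rfl hvol
    _ = ∫⁻ _ in A, ENNReal.ofReal κ := (setLIntegral_const A _).symm
    _ ≤ ∫⁻ y in A, f y := setLIntegral_mono' hAm hfA
    _ ≤ ∫⁻ y in U, f y := lintegral_mono_set hAU

/-- **Unconditional lower bound along the mass family** (every `s`, every `δ`): with
`R ≥ Kerr.afRadius a r₀ + 2|a|` and `w = min 1 ((1 + 2R)^{2δ})`,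
`dist_{s,δ}(Kerr.data M a r₀, Kerr.data M' a r₀)² ≥ 7R³ · w · (M − M')²/(2R)² · |B₁|`
(the `m = 0` term of the `h`-part over the dyadic shell `{R < ‖y‖ ≤ 2R}`, where the pointwise
bound `‖h_M − h_{M'}‖ ≥ |M − M'|/‖y‖` of `KerrMassPinning.lean` holds). -/
theorem dataWeightedSobolevEDist_kerr_ge [Kerr.Facts] [Kerr.SliceFacts] {M M' : ℝ} (hM : 0 ≤ M)
    (hM' : 0 ≤ M') (a r₀ : ℝ) (s : ℕ) (δ : ℝ) {R : ℝ} (hR : Kerr.afRadius a r₀ + 2 * |a| ≤ R) :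
    (ENNReal.ofReal (7 * R ^ 3 * (min 1 ((1 + 2 * R) ^ (2 * δ)) * ((M - M') ^ 2 / (2 * R) ^ 2))) *
        volume (Metric.ball (0 : E3) 1)) ^ (1 / 2 : ℝ) ≤
      InitialDataSet.dataWeightedSobolevEDist s δ (Kerr.data M a r₀ hM) (Kerr.data M' a r₀ hM') := by
  have hR0 : 0 < R := lt_of_lt_of_le (by have := Kerr.afRadius_pos a r₀; positivity) hR
  set g := (Kerr.data M a r₀ hM).hFun - (Kerr.data M' a r₀ hM').hFun with hg
  set w : ℝ := min 1 ((1 + 2 * R) ^ (2 * δ)) with hw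
  have hw0 : 0 ≤ w := le_min zero_le_one (Real.rpow_nonneg (by positivity) _)
  have h0 : ENNReal.ofReal (7 * R ^ 3 * (w * ((M - M') ^ 2 / (2 * R) ^ 2))) *
      volume (Metric.ball (0 : E3) 1) ≤
      ∫⁻ x in (Kerr.slice a r₀ : Set E3), ENNReal.ofReal
        ((1 + ‖x‖) ^ (2 * (δ + ((0 : ℕ) : ℝ)) : ℝ) * ‖iteratedFDeriv ℝ 0 g x‖ ^ 2) := by
    refine setLIntegral_ge_shell hR0 (fun y hy ↦ Kerr.mem_slice_of_lt_norm ?_) fun y hy hy2 ↦ ?_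
    · exact lt_of_le_of_lt (by linarith [abs_nonneg a]) hy
    · have hya : 2 * |a| ≤ ‖y‖ := by linarith [(Kerr.afRadius_pos a r₀).le]
      have hyU : y ∈ Kerr.slice a r₀ :=
        Kerr.mem_slice_of_lt_norm (lt_of_le_of_lt (by linarith [abs_nonneg a]) hy)
      have hy0 : 0 < ‖y‖ := hR0.trans hy
      rw [norm_iteratedFDeriv_zero]
      refine ENNReal.ofReal_le_ofReal ?_
      have hwt : w ≤ (1 + ‖y‖) ^ (2 * (δ + ((0 : ℕ) : ℝ)) : ℝ) := by
        have e : (2 * (δ + ((0 : ℕ) : ℝ)) : ℝ) = 2 * δ := by push_cast; ring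
        rw [e]
        rcases le_or_gt 0 (2 * δ) with hδ | hδ
        · exact le_trans (min_le_left _ _) (Real.one_le_rpow (by linarith [norm_nonneg y]) hδ)
        · exact le_trans (min_le_right _ _)
            (Real.rpow_le_rpow_of_nonpos (by linarith [norm_nonneg y]) (by linarith) hδ.le)
      have h2 : |M - M'| / ‖y‖ ≤ ‖g y‖ := by
        rw [hg, Pi.sub_apply]
        exact norm_hFun_sub_hFun_ge_kerr hM hM' hyU hya
      have h3 : |M - M'| / (2 * R) ≤ |M - M'| / ‖y‖ :=
        div_le_div_of_nonneg_left (abs_nonneg _) hy0 hy2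
      have h4 : (M - M') ^ 2 / (2 * R) ^ 2 ≤ ‖g y‖ ^ 2 := by
        rw [show (M - M') ^ 2 / (2 * R) ^ 2 = (|M - M'| / (2 * R)) ^ 2 by rw [div_pow, sq_abs]]
        exact pow_le_pow_left₀ (by positivity) (h3.trans h2) 2
      exact mul_le_mul hwt h4 (by positivity) (le_trans hw0 hwt)
  have hsemi : (ENNReal.ofReal (7 * R ^ 3 * (w * ((M - M') ^ 2 / (2 * R) ^ 2))) *
      volume (Metric.ball (0 : E3) 1)) ^ (1 / 2 : ℝ) ≤
      weightedSobolevSeminorm (Kerr.slice a r₀ : Set E3) s δ g := by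
    unfold weightedSobolevSeminorm
    refine ENNReal.rpow_le_rpow (h0.trans ?_) (by norm_num)
    exact Finset.single_le_sum (f := fun m : ℕ ↦ ∫⁻ x in (Kerr.slice a r₀ : Set E3), ENNReal.ofReal
      ((1 + ‖x‖) ^ (2 * (δ + m) : ℝ) * ‖iteratedFDeriv ℝ m g x‖ ^ 2)) (fun _ _ ↦ zero_le)
      (Finset.mem_range.2 (Nat.succ_pos s))
  unfold InitialDataSet.dataWeightedSobolevEDist
  rw [← hg]
  exact hsemi.trans le_self_add

/-- **Tightness of the ceiling, unconditionally: `γ ≥ 1` with a small constant clears the whole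
visible-edge part of the mass family, uniformly in the spin.** For every `M > 0` (and every
`s, δ`) there is `K' > 0` such that for every sub-extremal spin `a`, every `γ ≥ 1`, every
`0 ≤ c ≤ K'M/2` and every member `Kerr.data M' a M` of mass defect `M − M' ≥ Mχ/2`
(`χ = 1 − (a/M)²`; this includes every exposed-edge and every overspinning member), the member is
NOT in the near-extremal basin `c·χ^γ` around `Kerr.data M a M`. -/
theorem exists_const_basin_clears_visibleEdge [Kerr.Facts] [Kerr.SliceFacts] (s : ℕ) (δ : ℝ)
    {M : ℝ} (hM : 0 < M) :
    ∃ K' : ℝ, 0 < K' ∧ ∀ a : ℝ, Kerr.IsSubextremal M a → ∀ γ : ℝ, 1 ≤ γ →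
      ∀ c : ℝ, 0 ≤ c → c ≤ K' * M / 2 → ∀ (M' : ℝ) (hM' : 0 ≤ M'),
        M * (1 - (a / M) ^ 2) / 2 ≤ M - M' →
          ¬ InitialDataSet.dataWeightedSobolevEDist s δ (Kerr.data M' a M hM') (Kerr.data M a M hM.le) <
              ENNReal.ofReal (c * (1 - (a / M) ^ 2) ^ γ) := by
  set R : ℝ := 4 * M + 2 with hRdef
  have hR0 : 0 < R := by positivity
  set b : ℝ≥0∞ := volume (Metric.ball (0 : E3) 1) with hb
  have hb0 : b ≠ 0 :=
    (Metric.isOpen_ball.measure_pos volume ⟨0, Metric.mem_ball_self one_pos⟩).ne'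
  have hbtop : b ≠ ⊤ := measure_ball_lt_top.ne
  have hbr : 0 < b.toReal := ENNReal.toReal_pos hb0 hbtop
  set w : ℝ := min 1 ((1 + 2 * R) ^ (2 * δ)) with hw
  have hw0 : 0 < w := lt_min one_pos (Real.rpow_pos_of_pos (by positivity) _)
  set Q : ℝ := 7 * R ^ 3 * (w * (1 / (2 * R) ^ 2)) * b.toReal with hQ
  have hQ0 : 0 < Q := by positivity
  refine ⟨√Q, Real.sqrt_pos.2 hQ0, ?_⟩
  intro a ha γ hγ c hc0 hcK M' hM' hdef hlt
  have haM : |a| < M := ha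
  -- R dominates afRadius a M + 2|a|
  have hRa : Kerr.afRadius a M + 2 * |a| ≤ R := by
    unfold Kerr.afRadius
    rw [max_eq_left hM.le]
    have h1 : √(M ^ 2 + a ^ 2) ≤ M + |a| := by
      rw [Real.sqrt_le_left (by positivity)]
      nlinarith [abs_nonneg a, sq_abs a]
    rw [hRdef]
    linarith
  -- χ ∈ (0, 1]
  have hχ0 : 0 < 1 - (a / M) ^ 2 := by
    have h1 : |a / M| < 1 := by rwa [abs_div, abs_of_pos hM, div_lt_one hM]
    have h2 : (a / M) ^ 2 < 1 := (sq_lt_one_iff_abs_lt_one _).2 h1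
    linarith
  have hχ1 : 1 - (a / M) ^ 2 ≤ 1 := by linarith [sq_nonneg (a / M)]
  set χ := 1 - (a / M) ^ 2 with hχ
  -- the radius t of the basin is at most √Q · (M − M')
  set t : ℝ := c * χ ^ γ with ht
  have ht0 : 0 ≤ t := mul_nonneg hc0 (Real.rpow_nonneg hχ0.le _)
  have hΔ0 : 0 ≤ M - M' := le_trans (by positivity) hdef
  have htle : t ≤ √Q * (M - M') := by
    have h1 : χ ^ γ ≤ χ := by
      calc χ ^ γ ≤ χ ^ (1 : ℝ) := Real.rpow_le_rpow_of_exponent_ge hχ0 hχ1 hγ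
        _ = χ := Real.rpow_one χ
    calc t ≤ c * χ := mul_le_mul_of_nonneg_left h1 hc0
      _ ≤ √Q * M / 2 * χ := mul_le_mul_of_nonneg_right hcK hχ0.le
      _ = √Q * (M * χ / 2) := by ring
      _ ≤ √Q * (M - M') := mul_le_mul_of_nonneg_left hdef (Real.sqrt_nonneg _)
  -- the lower bound, in squared form
  have hlow := dataWeightedSobolevEDist_kerr_ge hM' hM.le a M s δ hRa
  rw [← hw] at hlow
  set X : ℝ≥0∞ := ENNReal.ofReal (7 * R ^ 3 * (w * ((M' - M) ^ 2 / (2 * R) ^ 2))) * b with hX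
  have hXt : X ^ (1 / 2 : ℝ) < ENNReal.ofReal t := lt_of_le_of_lt hlow hlt
  have hX2 : X < ENNReal.ofReal t ^ (2 : ℝ) := by
    have := ENNReal.rpow_lt_rpow hXt (by norm_num : (0 : ℝ) < 2)
    rwa [← ENNReal.rpow_mul, show (1 / 2 : ℝ) * 2 = 1 by norm_num, ENNReal.rpow_one] at this
  rw [ENNReal.ofReal_rpow_of_nonneg ht0 (by norm_num), Real.rpow_two] at hX2
  have hXeq : X = ENNReal.ofReal (Q * (M' - M) ^ 2) := by
    rw [hX, ← ENNReal.ofReal_toReal hbtop, ← ENNReal.ofReal_mul (by positivity)]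
    congr 1
    rw [hQ]
    ring
  rw [hXeq, ENNReal.ofReal_lt_ofReal_iff'] at hX2
  obtain ⟨hX2, -⟩ := hX2
  -- but t² ≤ Q (M − M')²
  have : t ^ 2 ≤ Q * (M' - M) ^ 2 := by
    have e : Q * (M' - M) ^ 2 = (√Q * (M - M')) ^ 2 := by
      rw [mul_pow, Real.sq_sqrt hQ0.le]
      ring
    rw [e]
    exact pow_le_pow_left₀ ht0 htle 2
  linarith

end Summit.FinalStateConjecture.FinalStateConjecture.Theorems.CaptureSuffices.Negative
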